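import Mathlib
import Summits.ValiantsHypothesis.ValiantsHypothesis.Theorems.NewtonUnitEquationsDissociatedUniformTotalsLawChains
import HarnessLib

/-!
# Crux `NewtonUnitEquations.DissociatedUniform` (stmt-ValiantsHypothesis-5905): the MODE TOOLKIT for the kinetic count on the convexly ordered stratum

Companion of `…TotalsLawChains` / `…TotalsLawChainCount` (every hull vertex of a fibre union `U_s(Z)` over a convexly ordered pair is
a chain point of a mode pair).  The uniform pointwise / totals rungs (`ConvexUnionVertBound C`, `C ∈ [3,4]`; `ConvexUnionTotalsBound 2`)
need the KINETIC structure of the modes along a chart `t ↦ (σ, t)` (memo `Cruxes/DissociatedUniform/NOTES-t1g6.md` §3: successive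
modes are ADJACENT labels, hence move monotonically; co-oriented pairs give nested chain windows, `≤ 4q − 2|W|` candidates).  This
file lands the static lemmas on cyclically unimodal sequences that this structure rests on:

* `CycUnimodalAt.eq_max_of_between` — the maximisers form an ARC: a label between two maximisers (along the witness order) is a
  maximiser;
* `CycUnimodalAt.eq_mode_of_strictLocalMax` — a STRICT local maximum is the mode (hence the global maximum);
* `CycUnimodalAt.adjacent_of_two_max` — if no three consecutive labels share the maximum value (e.g. no three consecutive points of
  the curve are collinear), two distinct maximisers are ADJACENT labels (`x' = x ± 1`): successive chart modes differ by one step;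
* `exists_higher_neighbour_of_isTop` / `exists_lower_neighbour_of_isTop` — along a chart `α_t = r + t·h` all of whose members are
  cyclically unimodal, a strict maximiser `x` of `α_{t₀}` is a STRICTLY MONOTONE POINT of the height `h`: if some label is higher
  (lower) than `x`, then so is one of its two neighbours (else `x` would be a strict local, non-global maximum of `α_t` for `t ≫ t₀`,
  resp. `t ≪ t₀`).
Honest label: lemmas; the kinetic count itself is NOT here; `ConvexUnionVertBound C` (`C ≥ 3`), `UnionTotalsLaw`, `TotalsLawThree`
remain OPEN; nothing here bears on VP ≠ VNP.
[folklore]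
-/

set_option linter.dupNamespace false -- `ValiantsHypothesis.ValiantsHypothesis` (summit = problem) in every name

open scoped BigOperators

namespace Summit.ValiantsHypothesis.ValiantsHypothesis.Theorems.NewtonUnitEquationsDissociatedUniform

namespace TotalsLaw

section Modes

variable {q : ℕ} [NeZero q]

/-- **The maximisers form an arc**: if the labels at positions `k₁ ≤ k₂` (counted from the witness start `n`) both carry the
maximum value `f (n + d)`, so does every position in between. [folklore] -/
theorem CycUnimodalAt.eq_max_of_between {f : ZMod q → ℝ} {n : ZMod q} {d : ℕ} (h : CycUnimodalAt f n d) {k₁ k k₂ : ℕ}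
    (h12 : k₁ ≤ k) (hk2 : k ≤ k₂) (hk2q : k₂ < q) (hmax1 : f (n + (k₁ : ZMod q)) = f (n + (d : ZMod q)))
    (hmax2 : f (n + (k₂ : ZMod q)) = f (n + (d : ZMod q))) : f (n + (k : ZMod q)) = f (n + (d : ZMod q)) := by
  refine le_antisymm (h.le_mode _) ?_
  rcases le_total k d with hkd | hdk
  · rw [← hmax1]; exact h.asc_le h12 hkd
  · rw [← hmax2]; exact h.desc_le hdk hk2 hk2q

/-- **A strict local maximum is the mode.**  If `f x` strictly exceeds both neighbours then `x = n + d` (so `f x` is the global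
maximum, `CycUnimodalAt.le_mode`). [folklore] -/
theorem CycUnimodalAt.eq_mode_of_strictLocalMax {f : ZMod q → ℝ} {n : ZMod q} {d : ℕ} (h : CycUnimodalAt f n d) {x : ZMod q}
    (hup : f (x + 1) < f x) (hdown : f (x - 1) < f x) : x = n + (d : ZMod q) := by
  set k := (x - n).val with hk
  have hkq : k < q := ZMod.val_lt _
  have hx : x = n + (k : ZMod q) := eq_add_val n x
  obtain ⟨hd, hasc, hdesc⟩ := h
  rcases Nat.lt_trichotomy k d with hlt | heq | hgt
  · -- ascending arc: `f x ≤ f (x + 1)`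
    have h1 := hasc k hlt
    rw [← hx, show n + ((k + 1 : ℕ) : ZMod q) = x + 1 by rw [hx]; push_cast; ring] at h1
    linarith
  · rw [hx, heq]
  · -- descending arc: `f x ≤ f (x - 1)`
    have hk1 : 1 ≤ k := by omega
    have h1 := hdesc (k - 1) (by omega) (by omega)
    rw [show k - 1 + 1 = k by omega, ← hx,
      show n + ((k - 1 : ℕ) : ZMod q) = x - 1 by rw [hx, Nat.cast_sub hk1]; push_cast; ring] at h1
    linarith

/-- **Two distinct maximisers are adjacent** when no three consecutive labels share the maximum (e.g. no three consecutive points of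
a convexly ordered curve are collinear): if `f x = f x' = max` with `x ≠ x'`, then `x' = x + 1` or `x' = x - 1`.  (Successive chart
modes of a locally strict convexly ordered curve differ by ONE label step.) [folklore] -/
theorem CycUnimodalAt.adjacent_of_two_max {f : ZMod q → ℝ} {n : ZMod q} {d : ℕ} (h : CycUnimodalAt f n d)
    (h3 : ∀ z : ZMod q, f z = f (n + (d : ZMod q)) → f (z + 1) = f (n + (d : ZMod q)) → f (z + 2) = f (n + (d : ZMod q)) → False)
    {x x' : ZMod q} (hne : x ≠ x') (hx : f x = f (n + (d : ZMod q))) (hx' : f x' = f (n + (d : ZMod q))) :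
    x' = x + 1 ∨ x' = x - 1 := by
  -- positions of `x`, `x'`
  set k := (x - n).val with hk
  set k' := (x' - n).val with hk'
  have hkq : k < q := ZMod.val_lt _
  have hk'q : k' < q := ZMod.val_lt _
  have hxe : x = n + (k : ZMod q) := eq_add_val n x
  have hx'e : x' = n + (k' : ZMod q) := eq_add_val n x'
  have hkk : k ≠ k' := fun he => hne (by rw [hxe, hx'e, he])
  -- every position between them is a maximiser; three in a row is excluded, so they are consecutive positions
  have key : ∀ {k₁ k₂ : ℕ}, k₁ < k₂ → k₂ < q → f (n + (k₁ : ZMod q)) = f (n + (d : ZMod q)) →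
      f (n + (k₂ : ZMod q)) = f (n + (d : ZMod q)) → k₂ = k₁ + 1 := by
    intro k₁ k₂ hlt h2q hm1 hm2
    by_contra hne2
    have hmid : f (n + ((k₁ + 1 : ℕ) : ZMod q)) = f (n + (d : ZMod q)) := h.eq_max_of_between (by omega) (by omega) h2q hm1 hm2
    have hmid2 : f (n + ((k₁ + 2 : ℕ) : ZMod q)) = f (n + (d : ZMod q)) := h.eq_max_of_between (by omega) (by omega) h2q hm1 hm2
    refine h3 (n + (k₁ : ZMod q)) hm1 ?_ ?_
    · rw [show n + (k₁ : ZMod q) + 1 = n + ((k₁ + 1 : ℕ) : ZMod q) by push_cast; ring]; exact hmid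
    · rw [show n + (k₁ : ZMod q) + 2 = n + ((k₁ + 2 : ℕ) : ZMod q) by push_cast; ring]; exact hmid2
  rw [hxe] at hx
  rw [hx'e] at hx'
  rcases Nat.lt_or_gt_of_ne hkk with hlt | hgt
  · left
    have := key hlt hk'q hx hx'
    rw [hx'e, hxe, this]; push_cast; ring
  · right
    have := key hgt hkq hx' hx
    rw [hx'e, hxe, this]; push_cast; ring

/-- **A chart mode is a strictly monotone point of the height (upper side).**  Along a chart `α_t = r + t·h` whose members are all
cyclically unimodal, if `x` is a strict maximiser of `α_{t₀}` and some label is higher than `x` (`h x < h y`), then one of the two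
neighbours of `x` is higher than `x`.  (Otherwise, for `t ≫ t₀`, `x` would strictly beat both neighbours while `y` beats `x` — a strict
local maximum that is not global.) [folklore] -/
theorem exists_higher_neighbour_of_isTop (r h : ZMod q → ℝ) (hcu : ∀ t : ℝ, CycUnimodal fun z => r z + t * h z) {t₀ : ℝ}
    {x : ZMod q} (htop : ∀ z : ZMod q, z ≠ x → r z + t₀ * h z < r x + t₀ * h x) {y : ZMod q} (hy : h x < h y) :
    h x < h (x + 1) ∨ h x < h (x - 1) := by
  by_contra hcon
  push Not at hcon
  obtain ⟨h1, h2⟩ := hcon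
  -- a late time at which `y` beats `x`
  set T : ℝ := (r x + t₀ * h x - (r y + t₀ * h y)) / (h y - h x) + 1 with hT
  have hyx : y ≠ x := fun he => by rw [he] at hy; exact lt_irrefl _ hy
  have hδ : 0 < r x + t₀ * h x - (r y + t₀ * h y) := by linarith [htop y hyx]
  have hgap : 0 < h y - h x := by linarith
  have hTpos : 0 < T := by rw [hT]; positivity
  have hTy : r x + (t₀ + T) * h x < r y + (t₀ + T) * h y := by
    have : (r x + t₀ * h x - (r y + t₀ * h y)) < T * (h y - h x) := by
      rw [hT, add_mul, div_mul_cancel₀ _ hgap.ne']; linarith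
    nlinarith
  -- at time `t₀ + T`, `x` strictly beats both neighbours
  obtain ⟨n, d, hnd⟩ := hcu (t₀ + T)
  have hq : x + 1 ≠ x ∨ (x + 1 = x) := ne_or_eq _ _
  rcases hq with hne1 | he1
  · have hne2 : x - 1 ≠ x := fun he => hne1 (by
      have : x = x - 1 + 1 := by ring
      rw [he] at this; exact this.symm)
    have hup : r (x + 1) + (t₀ + T) * h (x + 1) < r x + (t₀ + T) * h x := by nlinarith [htop (x + 1) hne1]
    have hdown : r (x - 1) + (t₀ + T) * h (x - 1) < r x + (t₀ + T) * h x := by nlinarith [htop (x - 1) hne2]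
    have hmode := hnd.eq_mode_of_strictLocalMax (f := fun z => r z + (t₀ + T) * h z) hup hdown
    have hle := hnd.le_mode (f := fun z => r z + (t₀ + T) * h z) y
    rw [← hmode] at hle
    linarith
  · -- `q = 1`: then `y = x`
    have h1 : (1 : ZMod q) = 0 := by simpa using he1
    have hq1 : q = 1 := by
      have := (ZMod.natCast_eq_zero_iff 1 q).1 (by exact_mod_cast h1)
      exact Nat.dvd_one.1 this
    subst hq1
    exact hyx (Subsingleton.elim y x)

/-- **… and (lower side)**: if some label is lower than the strict maximiser `x` of `α_{t₀}`, then one of the two neighbours of `x`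
is lower (look at `t ≪ t₀`). [folklore] -/
theorem exists_lower_neighbour_of_isTop (r h : ZMod q → ℝ) (hcu : ∀ t : ℝ, CycUnimodal fun z => r z + t * h z) {t₀ : ℝ}
    {x : ZMod q} (htop : ∀ z : ZMod q, z ≠ x → r z + t₀ * h z < r x + t₀ * h x) {y : ZMod q} (hy : h y < h x) :
    h (x + 1) < h x ∨ h (x - 1) < h x := by
  -- apply the upper-side lemma to the chart `t ↦ r + t·(-h)` read at `-t₀`
  have hcu' : ∀ t : ℝ, CycUnimodal fun z => r z + t * (-h z) := fun t => by
    have := hcu (-t)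
    simpa [neg_mul, mul_neg] using this
  have htop' : ∀ z : ZMod q, z ≠ x → r z + (-t₀) * (-h z) < r x + (-t₀) * (-h x) := fun z hz => by
    simpa [neg_mul, mul_neg] using htop z hz
  have := exists_higher_neighbour_of_isTop r (fun z => -h z) hcu' htop' (y := y) (by simpa using hy)
  rcases this with h1 | h1
  · exact Or.inl (by linarith)
  · exact Or.inr (by linarith)

omit [NeZero q] in
/-- **Local strictness from geometry**: if the consecutive edge vectors `(r(z+1) - r z, h(z+1) - h z)` and
`(r(z+2) - r(z+1), h(z+2) - h(z+1))` of the curve `z ↦ (r z, h z)` are not parallel (the three consecutive points are not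
collinear), then the three labels `z, z+1, z+2` cannot all carry the maximum of a chart function `α_t = r + t·h` — the hypothesis
of `CycUnimodalAt.adjacent_of_two_max` for every member of the chart. [folklore] -/
theorem not_three_max_of_det_ne (r h : ZMod q → ℝ) (t : ℝ) {n : ZMod q} {d : ℕ}
    (hdet : ∀ z : ZMod q, (r (z + 1) - r z) * (h (z + 2) - h (z + 1)) ≠ (h (z + 1) - h z) * (r (z + 2) - r (z + 1)))
    (z : ZMod q) (h0 : r z + t * h z = r (n + (d : ZMod q)) + t * h (n + (d : ZMod q)))
    (h1 : r (z + 1) + t * h (z + 1) = r (n + (d : ZMod q)) + t * h (n + (d : ZMod q)))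
    (h2 : r (z + 2) + t * h (z + 2) = r (n + (d : ZMod q)) + t * h (n + (d : ZMod q))) : False := by
  apply hdet z
  have e1 : r (z + 1) - r z = -(t * (h (z + 1) - h z)) := by linarith
  have e2 : r (z + 2) - r (z + 1) = -(t * (h (z + 2) - h (z + 1))) := by
    have : z + 2 = z + 1 + 1 := by ring
    linarith
  rw [e1, e2]; ring

/-- Hence, for a locally strict curve, two distinct maximisers of any chart function `α_t = r + t·h` that is cyclically unimodal
with witness `(n, d)` are adjacent labels. [folklore] -/
theorem adjacent_of_two_max_of_det_ne (r h : ZMod q → ℝ) (t : ℝ) {n : ZMod q} {d : ℕ}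
    (hcu : CycUnimodalAt (fun z => r z + t * h z) n d)
    (hdet : ∀ z : ZMod q, (r (z + 1) - r z) * (h (z + 2) - h (z + 1)) ≠ (h (z + 1) - h z) * (r (z + 2) - r (z + 1)))
    {x x' : ZMod q} (hne : x ≠ x') (hx : r x + t * h x = r (n + (d : ZMod q)) + t * h (n + (d : ZMod q)))
    (hx' : r x' + t * h x' = r (n + (d : ZMod q)) + t * h (n + (d : ZMod q))) : x' = x + 1 ∨ x' = x - 1 :=
  hcu.adjacent_of_two_max (f := fun z => r z + t * h z) (fun z h0 h1 h2 => not_three_max_of_det_ne r h t hdet z h0 h1 h2)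
    hne hx hx'

end Modes

end TotalsLaw

end Summit.ValiantsHypothesis.ValiantsHypothesis.Theorems.NewtonUnitEquationsDissociatedUniform
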